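import Literature.Geometry.Symplectic.SphereOpenBookForm
import Literature.Geometry.Symplectic.PlanarContactBoundary
import Literature.Topology.FourManifolds.RotationBody
import Literature.Geometry.Manifold.OpenEmbeddingCriterion
import HarnessLib

/-!
# The standard open book of `S³` (2/3): the tube is an open embedding; binding; fibration; derivatives

Second of three files on the standard (disc) open book of `S³ ⊂ ℂ²` (Etnyre 2006, §2–§3; Wendl
2020, §5.1, Fig. 5.1); overview in `SphereOpenBookForm.lean`.  This file:
* `SphereOpenBook.tubeInv`, `range_tube`, `isSmoothEmbedding_tube` — the tube
  `(p, w) ↦ (w, p)/√(1 + ‖w‖²)` is a `C^∞` embedding `S¹ × ℝ² → S³` with open image `{z₂ ≠ 0}`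
  (injective open `C^∞` map with a `C^∞` inverse on its range; the tree's
  `isSmoothEmbedding_of_leftInverse_of_isOpenMap`);
* `tubesBinding_eq` — the binding of the one-tube family is the circle `{z₁ = 0}`;
* `SphereOpenBook.proj` — the fibration `π(z) = z₁/‖z₁‖ : S³ → S¹` (junk on the binding), smooth
  off the binding, normal form `π(tube(p, w)) = w/‖w‖`, angular differential
  `dθ_y(n) = (y₀N₁ - y₁N₀)/‖z₁‖²` (`angularDeriv_proj`), nowhere zero off the binding;
* derivatives of the tube along its core: the binding tangent `(0, D¹_x v)` and the meridional
  frame `(h, 0)` read ambiently (`D_mfderiv_tube_horizontal`, `D_mfderiv_tube_vertical`).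

Adapted verbatim (namespace and imports only) from the standing disprover's crux work file
`Summits/SmoothPoincare4/SmoothPoincare4/Cruxes/PlanarBisectionRigidity/Disproof.lean`, §5a
(gen 3, v7.2, sorry-free).  References: J. B. Etnyre, *Lectures on open book decompositions and
contact structures*, Clay Math. Proc. 5 (2006), §2 [Etnyre2006]; C. Wendl, *Lectures on Contact
3-Manifolds, Holomorphic Curves and Intersection Theory* (2020), §5.1, Fig. 5.1 [Wendl2020].
-/

noncomputable section

open scoped Manifold ContDiff Topology RealInnerProductSpace
open Set Function

namespace Literature.Geometry.Symplectic

namespace SphereOpenBook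

open Literature.Geometry.Kaehler Literature.Topology.FourManifolds

/-- Local notation: `ℝ⁴ = ℂ²`. -/
local notation "E4" => EuclideanSpace ℝ (Fin 4)
/-- Local notation: `ℝ³` (the chart model of `S³`). -/
local notation "E3" => EuclideanSpace ℝ (Fin 3)
/-- Local notation: `ℝ² = ℂ`. -/
local notation "E2" => EuclideanSpace ℝ (Fin 2)
/-- Local notation: `ℝ¹` (the chart model of `S¹`). -/
local notation "E1" => EuclideanSpace ℝ (Fin 1)
/-- Local notation: the unit sphere `S³ ⊂ ℂ²`. -/
local notation "S3" => (Metric.sphere (0 : EuclideanSpace ℝ (Fin 4)) 1)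
/-- Local notation: the unit circle `S¹ ⊂ ℂ`. -/
local notation "S1" => (Metric.sphere (0 : EuclideanSpace ℝ (Fin 2)) 1)
/-- Local notation: the standard complex structure `J₀` of `ℝ⁴ = ℂ²`. -/
local notation "J₀" => stdComplexStructure

attribute [local instance] Literature.Topology.FourManifolds.fact_finrank_euclideanSpace_succ

/-- **The inverse of the tube on `{z₂ ≠ 0}`**: `z ↦ (z₂/‖z₂‖, z₁/‖z₂‖)`. [folklore] -/
def tubeInv (z : S3) : S1 × E2 :=
  (RotationBody.sphN (m := 1) (pr₂ (z : E4)), ‖pr₂ (z : E4)‖⁻¹ • pr₁ (z : E4))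

/-- `tubeInv ∘ tube = id`. [folklore] -/
theorem tubeInv_tube (q : S1 × E2) : tubeInv (tube q) = q := by
  obtain ⟨p, w⟩ := q
  simp only [tubeInv]
  rw [norm_pr₂_tube, pr₂_tube, pr₁_tube,
    RotationBody.sphN_smul (tubeScale_pos w) (ne_zero_of_mem_unit_sphere p), RotationBody.sphN_coe,
    smul_smul, inv_mul_cancel₀ (tubeScale_pos w).ne', one_smul]

/-- The tube is injective. [folklore] -/
theorem injective_tube : Injective tube :=
  HasLeftInverse.injective ⟨tubeInv, tubeInv_tube⟩

/-- `tube ∘ tubeInv = id` on `{z₂ ≠ 0}`. [folklore] -/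
theorem tube_tubeInv {z : S3} (hz : pr₂ (z : E4) ≠ 0) : tube (tubeInv z) = z := by
  have hn : 0 < ‖pr₂ (z : E4)‖ := norm_pos_iff.2 hz
  have hw : ‖‖pr₂ (z : E4)‖⁻¹ • pr₁ (z : E4)‖ ^ 2 = ‖pr₂ (z : E4)‖⁻¹ ^ 2 * ‖pr₁ (z : E4)‖ ^ 2 := by
    rw [norm_smul, mul_pow, norm_inv, norm_norm]
  have hs : tubeScale (‖pr₂ (z : E4)‖⁻¹ • pr₁ (z : E4)) = ‖pr₂ (z : E4)‖ := by
    have h1 : 1 + ‖‖pr₂ (z : E4)‖⁻¹ • pr₁ (z : E4)‖ ^ 2 = (‖pr₂ (z : E4)‖⁻¹) ^ 2 := by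
      rw [hw]
      have := norm_sq_pr_add z
      field_simp
      nlinarith [this]
    rw [tubeScale, h1, Real.sqrt_sq (inv_nonneg.2 hn.le), inv_inv]
  apply Subtype.ext
  apply_fun join ∘ fun x : E4 => (pr₁ x, pr₂ x) using
    fun a b h => by simpa [join_pr] using h
  simp only [comp_apply, join_pr, tubeInv, coe_tube, tubeAmb, hs, RotationBody.coe_sphN hz]
  ext i
  fin_cases i <;> simp [mul_inv_cancel_left₀ hn.ne']

/-- **The image of the tube is `{z₂ ≠ 0}`.** [folklore] -/
theorem range_tube : range tube = {z : S3 | pr₂ (z : E4) ≠ 0} := by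
  ext z
  constructor
  · rintro ⟨⟨p, w⟩, rfl⟩
    exact pr₂_tube_ne_zero p w
  · intro hz
    exact ⟨tubeInv z, tube_tubeInv hz⟩

/-- The image of the tube is open. [folklore] -/
theorem isOpen_range_tube : IsOpen (range tube) := by
  rw [range_tube]
  exact isOpen_ne.preimage (pr₂.continuous.comp continuous_subtype_val)

/-- `tubeInv` is `C^∞` on `{z₂ ≠ 0}`. [folklore] -/
theorem contMDiffOn_tubeInv : ContMDiffOn (𝓡 3) ((𝓡 1).prod 𝓘(ℝ, E2)) ∞ tubeInv (range tube) := by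
  rw [range_tube]
  have hval : ContMDiff (𝓡 3) 𝓘(ℝ, E4) ∞ (Subtype.val : S3 → E4) := contMDiff_coe_sphere (n := 3)
  have h2 : ContMDiff (𝓡 3) 𝓘(ℝ, E2) ∞ fun z : S3 => pr₂ (z : E4) := pr₂.contDiff.contMDiff.comp hval
  have h1 : ContMDiff (𝓡 3) 𝓘(ℝ, E2) ∞ fun z : S3 => pr₁ (z : E4) := pr₁.contDiff.contMDiff.comp hval
  have h3 : ContMDiffOn (𝓡 3) 𝓘(ℝ) ∞ (fun z : S3 => ‖pr₂ (z : E4)‖) {z : S3 | pr₂ (z : E4) ≠ 0} :=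
    fun z hz => (contDiffAt_norm ℝ hz).comp_contMDiffWithinAt (f := fun z : S3 => pr₂ (z : E4))
      (x := z) (h2 z).contMDiffWithinAt
  have h4 : ContMDiffOn (𝓡 3) 𝓘(ℝ) ∞ (fun z : S3 => ‖pr₂ (z : E4)‖⁻¹) {z : S3 | pr₂ (z : E4) ≠ 0} :=
    fun z hz => (contDiffAt_inv ℝ (norm_ne_zero_iff.2 hz)).comp_contMDiffWithinAt
      (f := fun z : S3 => ‖pr₂ (z : E4)‖) (x := z) (h3 z hz)
  refine ContMDiffOn.prodMk ?_ (h4.smul h1.contMDiffOn)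
  exact RotationBody.contMDiffOn_sphN.comp h2.contMDiffOn fun z hz => hz

/-! ### The tube is an open smooth embedding -/

/-- The tube is an open map (continuous inverse on its open range). [folklore] -/
theorem isOpenMap_tube : IsOpenMap tube := by
  intro U hU
  have hcont : ContinuousOn tubeInv (range tube) := contMDiffOn_tubeInv.continuousOn
  have h : tube '' U = range tube ∩ tubeInv ⁻¹' U := by
    ext z
    constructor
    · rintro ⟨q, hq, rfl⟩
      exact ⟨mem_range_self q, by rwa [mem_preimage, tubeInv_tube]⟩
    · rintro ⟨⟨q, rfl⟩, hz⟩
      rw [mem_preimage, tubeInv_tube] at hz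
      exact ⟨q, hz, rfl⟩
  rw [h]
  exact hcont.isOpen_inter_preimage isOpen_range_tube hU

/-- `ℝ¹ × ℝ² ≅ ℝ³` (dimension count for the embedding criterion). [folklore] -/
def modelEquiv : (E1 × E2) ≃L[ℝ] E3 :=
  ContinuousLinearEquiv.ofFinrankEq (by simp [Module.finrank_prod])

/-- **The tube is a `C^∞` embedding** (injective open `C^∞` map with a `C^∞` inverse on its
range; the tree's `isSmoothEmbedding_of_leftInverse_of_isOpenMap`). [folklore] -/
theorem isSmoothEmbedding_tube : Manifold.IsSmoothEmbedding ((𝓡 1).prod 𝓘(ℝ, E2)) (𝓡 3) ∞ tube :=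
  (Literature.Geometry.Manifold.isSmoothEmbedding_of_leftInverse_of_isOpenMap contMDiff_tube
    injective_tube isOpenMap_tube contMDiffOn_tubeInv tubeInv_tube modelEquiv).1

/-! ### The binding `{z₁ = 0}` and the fibration `π = z₁/‖z₁‖` -/

/-- Points with `z₁ = 0` have `‖z₂‖ = 1`. [folklore] -/
theorem norm_pr₂_of_pr₁_eq_zero {z : S3} (hz : pr₁ (z : E4) = 0) : ‖pr₂ (z : E4)‖ = 1 := by
  have h := norm_sq_pr_add z
  rw [hz, norm_zero, zero_pow two_ne_zero, zero_add] at h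
  exact (pow_eq_one_iff_of_nonneg (norm_nonneg _) two_ne_zero).1 h

/-- The core of the tube is `w = 0 ↦ (0, p)`. [folklore] -/
theorem coe_tube_zero (p : S1) : (tube (p, 0) : E4) = join (0, (p : E2)) := by
  rw [coe_tube, tubeAmb]
  simp

/-- **The binding of the one-tube family is the circle `{z₁ = 0}`.** [folklore] -/
theorem tubesBinding_eq : tubesBinding (fun _ : Fin 1 => tube) = {z : S3 | pr₁ (z : E4) = 0} := by
  ext z
  rw [mem_tubesBinding_iff, mem_setOf_eq]
  constructor
  · rintro ⟨-, p, rfl⟩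
    rw [pr₁_tube, smul_zero]
  · intro hz
    refine ⟨0, ⟨pr₂ (z : E4), mem_sphere_zero_iff_norm.2 (norm_pr₂_of_pr₁_eq_zero hz)⟩, ?_⟩
    apply Subtype.ext
    rw [coe_tube_zero]
    conv_rhs => rw [← join_pr (z : E4)]
    rw [hz]

/-- **The fibration `π : S³ → S¹`, `π(z) = z₁/‖z₁‖`** (junk value on the binding `z₁ = 0`).
[folklore] -/
def proj (z : S3) : S1 :=
  RotationBody.sphN (m := 1) (pr₁ (z : E4))

/-- Normal form: `π(tube(p, w)) = w/‖w‖` for `w ≠ 0`. [folklore] -/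
theorem coe_proj_tube (p : S1) {w : E2} (hw : w ≠ 0) :
    ((proj (tube (p, w)) : S1) : E2) = ‖w‖⁻¹ • w := by
  rw [proj, pr₁_tube, RotationBody.sphN_smul (tubeScale_pos w) hw, RotationBody.coe_sphN hw]

/-- `z ↦ z₁` is `C^∞` on `S³`. [folklore] -/
theorem contMDiff_pr₁ : ContMDiff (𝓡 3) 𝓘(ℝ, E2) ∞ fun z : S3 => pr₁ (z : E4) :=
  pr₁.contDiff.contMDiff.comp (contMDiff_coe_sphere (n := 3))

/-- `π` is `C^∞` off the binding. [folklore] -/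
theorem contMDiffOn_proj : ContMDiffOn (𝓡 3) (𝓡 1) ∞ proj {z : S3 | pr₁ (z : E4) ≠ 0} :=
  RotationBody.contMDiffOn_sphN.comp contMDiff_pr₁.contMDiffOn fun _ hz => hz

/-- `π` read in `ℝ²` is `sphFun` after `z ↦ z₁` (definitional). [folklore] -/
theorem coe_proj_eq : (fun z : S3 => ((proj z : S1) : E2)) =
    (RotationBody.sphFun ∘ ⇑pr₁) ∘ (Subtype.val : S3 → E4) :=
  rfl

/-! ### Derivatives: the normalisation `v ↦ v/‖v‖`, the angular differential of `π` -/

/-- **The derivative of `v ↦ v/‖v‖` at `u ≠ 0` has the shape `h ↦ ‖u‖⁻¹ h + ℓ(h) u`** for some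
linear functional `ℓ` (the precise `ℓ = -⟪u, ·⟫/‖u‖³` is never needed: the `u`-component drops
out of the angle form). [folklore] -/
theorem hasFDerivAt_normalize {u : E2} (hu : u ≠ 0) :
    ∃ ℓ : E2 →L[ℝ] ℝ, HasFDerivAt (fun v : E2 => ‖v‖⁻¹ • v)
      (‖u‖⁻¹ • ContinuousLinearMap.id ℝ E2 + ℓ.smulRight u) u := by
  have hs' : ContDiffAt ℝ ∞ (fun v : E2 => ‖v‖⁻¹) u :=
    (contDiffAt_norm ℝ hu).inv (norm_ne_zero_iff.2 hu)
  have hs : DifferentiableAt ℝ (fun v : E2 => ‖v‖⁻¹) u := hs'.differentiableAt (by simp)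
  exact ⟨fderiv ℝ (fun v : E2 => ‖v‖⁻¹) u, hs.hasFDerivAt.smul (hasFDerivAt_id u)⟩

/-- `sphFun = (v ↦ v/‖v‖)` near any `u ≠ 0`. [folklore] -/
theorem sphFun_eventuallyEq {u : E2} (hu : u ≠ 0) :
    (RotationBody.sphFun : E2 → E2) =ᶠ[𝓝 u] fun v => ‖v‖⁻¹ • v := by
  filter_upwards [isOpen_ne.mem_nhds hu] with v hv
  simp [RotationBody.sphFun, show v ≠ 0 from hv]

/-- The angle form kills the radial component: `dφ_{u/‖u‖}(‖u‖⁻¹ h + c u) = (u₀h₁ - u₁h₀)/‖u‖²`.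
[folklore] -/
theorem angleForm_normalize (u h : E2) (c : ℝ) :
    angleForm (‖u‖⁻¹ • u) (‖u‖⁻¹ • h + c • u) = (‖u‖ ^ 2)⁻¹ * (u 0 * h 1 - u 1 * h 0) := by
  rw [angleForm_apply]
  simp only [PiLp.smul_apply, PiLp.add_apply, smul_eq_mul]
  rw [← inv_pow]
  ring

/-- **The angular differential of `π` at `y ∉ B`**: `dθ_y(n) = (y₀ N₁ - y₁ N₀)/‖z₁(y)‖²` with
`N = D_y n` the ambient tangent vector. [folklore] -/
theorem angularDeriv_proj {y : S3} (hy : pr₁ (y : E4) ≠ 0) (n : E3) :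
    angularDeriv proj y n =
      (‖pr₁ (y : E4)‖ ^ 2)⁻¹ * ((y : E4) 0 * D y n 1 - (y : E4) 1 * D y n 0) := by
  obtain ⟨ℓ, hℓ⟩ := hasFDerivAt_normalize hy
  set L : E2 →L[ℝ] E2 :=
    ‖pr₁ (y : E4)‖⁻¹ • ContinuousLinearMap.id ℝ E2 + ℓ.smulRight (pr₁ (y : E4)) with hL
  -- the ambient map `g = sphFun ∘ z₁` is differentiable at `y` with derivative `L ∘ z₁`
  have hg : HasFDerivAt (RotationBody.sphFun ∘ ⇑pr₁) (L.comp pr₁) (y : E4) :=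
    (hℓ.congr_of_eventuallyEq (sphFun_eventuallyEq hy)).comp (y : E4) pr₁.hasFDerivAt
  have hgm : HasMFDerivAt 𝓘(ℝ, E4) 𝓘(ℝ, E2) (RotationBody.sphFun ∘ ⇑pr₁) (y : E4) (L.comp pr₁) :=
    hasMFDerivAt_iff_hasFDerivAt.2 hg
  have hval : HasMFDerivAt (𝓡 3) 𝓘(ℝ, E4) (Subtype.val : S3 → E4) y (D y) :=
    ((contMDiff_coe_sphere (m := ∞) (n := 3) y).mdifferentiableAt (by simp)).hasMFDerivAt
  have hcomp := hgm.comp y hval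
  rw [angularDeriv_apply, coe_proj_eq, hcomp.mfderiv]
  have hp : ((proj y : S1) : E2) = ‖pr₁ (y : E4)‖⁻¹ • pr₁ (y : E4) := RotationBody.coe_sphN hy
  rw [hp]
  show angleForm (‖pr₁ (y : E4)‖⁻¹ • pr₁ (y : E4)) (L (pr₁ (D y n))) = _
  rw [hL]
  show angleForm (‖pr₁ (y : E4)‖⁻¹ • pr₁ (y : E4))
      (‖pr₁ (y : E4)‖⁻¹ • pr₁ (D y n) + ℓ (pr₁ (D y n)) • pr₁ (y : E4)) = _
  rw [angleForm_normalize]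
  rfl

/-! ### Derivatives of the tube along its core: the binding tangent and the meridional frame -/

/-- **`D¹_x`: the differential of the inclusion `S¹ ↪ ℝ²`** at `x`. [folklore] -/
def D₁ (x : S1) : E1 →L[ℝ] E2 :=
  mfderiv (𝓡 1) 𝓘(ℝ, E2) (Subtype.val : S1 → E2) x

/-- The range of `D¹_x` is the orthogonal complement of `x` (Mathlib). [folklore] -/
theorem range_D₁ (x : S1) : (D₁ x).range = (ℝ ∙ (x : E2))ᗮ :=
  range_mfderiv_coe_sphere (n := 1) x

/-- Tangent vectors of the circle are orthogonal to the position vector. [folklore] -/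
theorem inner_D₁ (x : S1) (v : E1) : ⟪(x : E2), D₁ x v⟫ = 0 := by
  have h : D₁ x v ∈ (D₁ x).range := ⟨v, rfl⟩
  rw [range_D₁] at h
  exact (Submodule.mem_orthogonal_singleton_iff_inner_right).1 h

/-- `D¹_x` is injective. [folklore] -/
theorem D₁_injective (x : S1) : Injective (D₁ x) :=
  mfderiv_coe_sphere_injective (n := 1) x

/-- The inclusion `S¹ ↪ ℝ²` has derivative `D¹_x`. [folklore] -/
theorem hasMFDerivAt_val₁ (x : S1) :
    HasMFDerivAt (𝓡 1) 𝓘(ℝ, E2) (Subtype.val : S1 → E2) x (D₁ x) :=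
  ((contMDiff_coe_sphere (m := ∞) (n := 1) x).mdifferentiableAt (by simp)).hasMFDerivAt

/-- The inclusion `S³ ↪ ℝ⁴` has derivative `D_y`. [folklore] -/
theorem hasMFDerivAt_val (y : S3) :
    HasMFDerivAt (𝓡 3) 𝓘(ℝ, E4) (Subtype.val : S3 → E4) y (D y) :=
  ((contMDiff_coe_sphere (m := ∞) (n := 3) y).mdifferentiableAt (by simp)).hasMFDerivAt

/-- The tube is differentiable. [folklore] -/
theorem mdifferentiableAt_tube (q : S1 × E2) :
    MDifferentiableAt ((𝓡 1).prod 𝓘(ℝ, E2)) (𝓡 3) tube q :=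
  (contMDiff_tube q).mdifferentiableAt (by simp)

/-- Along the core the tube is the linear map `p ↦ (0, p)` restricted to `S¹`. [folklore] -/
theorem val_tube_core_eq :
    ((Subtype.val : S3 → E4) ∘ tube ∘ fun p : S1 => (p, (0 : E2))) =
      ⇑(join.comp (ContinuousLinearMap.inr ℝ E2 E2)) ∘ (Subtype.val : S1 → E2) := by
  funext p
  simp only [comp_apply, coe_tube_zero, ContinuousLinearMap.coe_comp, ContinuousLinearMap.inr_apply]

/-- **The binding tangent read ambiently**: `D (∂_v tube(·, 0)) = (0, D¹_x v)` — the tangent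
vector of the binding circle `{z₁ = 0}`. [folklore] -/
theorem D_mfderiv_tube_horizontal (x : S1) (v : E1) :
    D (tube (x, 0)) (mfderiv ((𝓡 1).prod 𝓘(ℝ, E2)) (𝓡 3) tube (x, 0) (v, 0)) =
      join (0, D₁ x v) := by
  have hc : HasMFDerivAt (𝓡 1) ((𝓡 1).prod 𝓘(ℝ, E2)) (fun p : S1 => (p, (0 : E2))) x
      ((ContinuousLinearMap.id ℝ E1).prod (0 : E1 →L[ℝ] E2)) :=
    (hasMFDerivAt_id x).prodMk (hasMFDerivAt_const (0 : E2) x)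
  have htc : HasMFDerivAt (𝓡 1) (𝓡 3) (tube ∘ fun p : S1 => (p, (0 : E2))) x
      ((mfderiv ((𝓡 1).prod 𝓘(ℝ, E2)) (𝓡 3) tube (x, 0)).comp
        ((ContinuousLinearMap.id ℝ E1).prod (0 : E1 →L[ℝ] E2))) :=
    (mdifferentiableAt_tube (x, 0)).hasMFDerivAt.comp x hc
  have hvtc := (hasMFDerivAt_val (tube (x, 0))).comp x htc
  have hlin : HasMFDerivAt (𝓡 1) 𝓘(ℝ, E4)
      (⇑(join.comp (ContinuousLinearMap.inr ℝ E2 E2)) ∘ (Subtype.val : S1 → E2)) x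
      ((join.comp (ContinuousLinearMap.inr ℝ E2 E2)).comp (D₁ x)) :=
    (hasMFDerivAt_iff_hasFDerivAt.2 (join.comp (ContinuousLinearMap.inr ℝ E2 E2)).hasFDerivAt).comp
      x (hasMFDerivAt_val₁ x)
  have heq : (Subtype.val : S3 → E4) ∘ (tube ∘ fun p : S1 => (p, (0 : E2))) =
      ⇑(join.comp (ContinuousLinearMap.inr ℝ E2 E2)) ∘ (Subtype.val : S1 → E2) :=
    val_tube_core_eq
  rw [heq] at hvtc
  exact congrArg (fun L : E1 →L[ℝ] E4 => L v) (hvtc.mfderiv.symm.trans hlin.mfderiv)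

/-- `s` has vanishing derivative at `w = 0` (it is even). [folklore] -/
theorem hasFDerivAt_tubeScale_zero : HasFDerivAt tubeScale (0 : E2 →L[ℝ] ℝ) 0 := by
  have h1 : HasFDerivAt (fun w : E2 => 1 + ‖w‖ ^ 2) (0 : E2 →L[ℝ] ℝ) 0 := by
    have := ((hasStrictFDerivAt_norm_sq (0 : E2)).hasFDerivAt).const_add 1
    simpa using this
  have h2 : HasFDerivAt (fun w : E2 => √(1 + ‖w‖ ^ 2)) (0 : E2 →L[ℝ] ℝ) 0 := by
    have := h1.sqrt (by simp)
    simpa using this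
  have h3 := (hasDerivAt_inv (x := √(1 + ‖(0 : E2)‖ ^ 2)) (by simp)).comp_hasFDerivAt (0 : E2) h2
  rw [smul_zero] at h3
  exact h3

/-- **The tube in the meridional direction at the core**: `∂_h tube(p, ·)|₀ = (h, 0)` ambiently.
[folklore] -/
theorem hasFDerivAt_tubeAmb_vertical (a : E2) :
    HasFDerivAt (fun w : E2 => tubeAmb (a, w)) (join.comp (ContinuousLinearMap.inl ℝ E2 E2)) 0 := by
  have hj : HasFDerivAt (fun w : E2 => join (w, a)) (join.comp (ContinuousLinearMap.inl ℝ E2 E2)) 0 :=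
    join.hasFDerivAt.comp (0 : E2) ((hasFDerivAt_id (0 : E2)).prodMk (hasFDerivAt_const a (0 : E2)))
  have h := hasFDerivAt_tubeScale_zero.smul hj
  have hz : (0 : E2 →L[ℝ] ℝ).smulRight (join ((0 : E2), a)) = 0 := by
    ext v i
    simp
  rw [tubeScale_zero, one_smul, hz, add_zero] at h
  exact h

/-- **The meridional frame read ambiently**: `D (∂_h tube(x, ·)|₀) = (h, 0)`. [folklore] -/
theorem D_mfderiv_tube_vertical (x : S1) (h : E2) :
    D (tube (x, 0)) (mfderiv ((𝓡 1).prod 𝓘(ℝ, E2)) (𝓡 3) tube (x, 0) (0, h)) = join (h, 0) := by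
  have hd : HasMFDerivAt 𝓘(ℝ, E2) ((𝓡 1).prod 𝓘(ℝ, E2)) (fun w : E2 => (x, w)) 0
      ((0 : E2 →L[ℝ] E1).prod (ContinuousLinearMap.id ℝ E2)) :=
    (hasMFDerivAt_const x (0 : E2)).prodMk (hasMFDerivAt_id (0 : E2))
  have htd : HasMFDerivAt 𝓘(ℝ, E2) (𝓡 3) (tube ∘ fun w : E2 => (x, w)) 0
      ((mfderiv ((𝓡 1).prod 𝓘(ℝ, E2)) (𝓡 3) tube (x, 0)).comp
        ((0 : E2 →L[ℝ] E1).prod (ContinuousLinearMap.id ℝ E2))) :=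
    (mdifferentiableAt_tube (x, 0)).hasMFDerivAt.comp (0 : E2) hd
  have hvtd := (hasMFDerivAt_val (tube (x, 0))).comp (0 : E2) htd
  have hlin : HasMFDerivAt 𝓘(ℝ, E2) 𝓘(ℝ, E4) (fun w : E2 => tubeAmb ((x : E2), w)) 0
      (join.comp (ContinuousLinearMap.inl ℝ E2 E2)) :=
    hasMFDerivAt_iff_hasFDerivAt.2 (hasFDerivAt_tubeAmb_vertical (x : E2))
  have heq : (Subtype.val : S3 → E4) ∘ (tube ∘ fun w : E2 => (x, w)) =
      fun w : E2 => tubeAmb ((x : E2), w) := rfl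
  rw [heq] at hvtd
  exact congrArg (fun L : E2 →L[ℝ] E4 => L h) (hvtd.mfderiv.symm.trans hlin.mfderiv)

/-! ### The standard open book of `S³` -/

/-- The binding meets the tube exactly in its core. [folklore] -/
theorem tube_eq_core_imp (x x' : S1) (w : E2) (h : tube (x, w) = tube (x', 0)) : w = 0 := by
  have h' := congrArg (fun z : S3 => pr₁ (z : E4)) h
  simp only [pr₁_tube, smul_zero] at h'
  exact (smul_eq_zero.1 h').resolve_left (tubeScale_pos w).ne'

/-- The ambient vector `(-y₁, y₀, 0, 0)` (rotation of `z₁`), tangent to `S³` at `y`. [folklore] -/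
def rotVec (y : E4) : E4 := join (!₂[-(y 1), y 0], 0)

/-- The rotation vector is tangent to the sphere: `⟪y, (-y₁, y₀, 0, 0)⟫ = 0`. [folklore] -/
theorem inner_rotVec (y : E4) : ⟪y, rotVec y⟫ = 0 := by
  rw [inner_eq_sum, rotVec]
  simp
  ring

/-- **`π` is a submersion off the binding**: `dθ_y ≠ 0` for `z₁(y) ≠ 0` (it takes the value `1`
on the rotation vector `(-y₁, y₀, 0, 0)`). [folklore] -/
theorem angularDeriv_proj_ne_zero {y : S3} (hy : pr₁ (y : E4) ≠ 0) : angularDeriv proj y ≠ 0 := by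
  obtain ⟨n, hn⟩ := exists_D_eq y (inner_rotVec (y : E4))
  have hr : 0 < ‖pr₁ (y : E4)‖ ^ 2 := by positivity
  rw [norm_sq_eq₂] at hr
  simp only [pr₁_apply_zero, pr₁_apply_one] at hr
  have h1 : angularDeriv proj y n = 1 := by
    rw [angularDeriv_proj hy, hn, rotVec, norm_sq_eq₂]
    simp only [join_apply_zero, join_apply_one, pr₁_apply_zero, pr₁_apply_one]
    simp only [Matrix.cons_val_zero, Matrix.cons_val_one]
    rw [mul_neg, sub_neg_eq_add, inv_mul_cancel₀ hr.ne']
  intro h0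
  rw [h0] at h1
  exact zero_ne_one h1

end SphereOpenBook

end Literature.Geometry.Symplectic
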